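import Literature.Barriers.ValiantsHypothesis.CT23ExplicitAnnihilatorCircuit
import HarnessLib

/-!
# The explicit annihilator encoder, GENERIC in its sub-circuits, and constant-freeness
# (Chatterjee–Tengse arXiv:2309.07612v2, Lemma 3.5 = v1 Lemma 42 "all the three expressions …
# are constant-free, algebraic expressions"; val-lit p2 g8, X-CT23 engine brick E-e′, file 4 —
# interface R4 of the assembly seat)

Theorem-only (plus plumbing `def`s) companion of `CT23ExplicitAnnihilatorCircuit.lean` (this
seat: `encCircuit`, smallest sub-circuits with constants, for Thm. 3.1); NO named facts. Honest
framing: circuit bookkeeping for a printed `VPSPACE` construction (consequences-side literature);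
it discharges nothing by itself; `VP ≠ VNP` is NOT proved and nothing here bears on it.

## Why a second circuit file

`exists_encoderCircuit` (file 3) chooses SMALLEST fan-in-two circuits for the Kronecker
coordinates `pow(i)_k` and for the skeleton, with field CONSTANTS allowed — enough for Thm. 3.1,
whose typed conclusion has no constant-freeness clause. Lemma 4.7's path (the assembly seat's
`IntEngine`, over `ℤ` after a run over `ℚ`) needs the encoder circuit to be CONSTANT-FREE whenever
the row circuits are (`α ∈ ℕ`, the powers `α^{2^ℓ Δ^k}` built from `±1` by square-and-multiply).
This file therefore redoes the construction GENERICALLY in the stage-A circuits `A k` (any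
fan-in-two circuits computing `kronPow a α Δ k`) and the skeleton circuit `S` (any fan-in-two
circuit computing `encoderSkeleton x a b Kb (X ∘ p)`), under new names (`stageAW`, `stageBW`,
`rowOutW`, `encCircuitWith`, …; the landed file's `rowRelabel`, `rowSubst`, `substCompat_row`,
`aeval_kronPow_of_fix`, `CircLayout` are reused by name), and proves besides `eval_/size_/
isFanInTwo_/projVars_encCircuitWith` the propagation **`hasSignConstants_encCircuitWith`**:
constant-free `A`, `S`, `Q` give a constant-free encoder. Packaged: `exists_encoderCircuit_signConst`
(conclusion adds `C.HasSignConstants`, size `≤ n·s + m·sA + |S|`). Supplying constant-free `A`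
(numeral `α`) and `S` with explicit log-size bounds is the numerals brick (separate file).

## References

* [ChatterjeeTengse2023] P. Chatterjee, A. Tengse, *Lower Bounds from Succinct Hitting Sets*,
  arXiv:2309.07612v2, Lemma 3.5 and its proof (v1: Lemma 42, p0015.txt:L80–L102, p0016.txt:L1–L8).
* [Burgisser2000] P. Bürgisser, *Completeness and Reduction in Algebraic Complexity Theory*,
  Springer 2000, §1.4 (constant-free circuits), Rem. 2.7 (substitution).
-/

noncomputable section

open MvPolynomial Matrix

namespace Literature.Barriers.ValiantsHypothesis

namespace CT23Encoder

open Literature.Computability.AlgebraicComplexity BitGadget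

universe u v

variable {F : Type u} [Field F] {τ : Type v} [DecidableEq τ]

section Generic

variable {n m δ w : ℕ}

omit [DecidableEq τ] in
/-- `p` is injective (private: a generic injectivity shape). [cite: ChatterjeeTengse2023, Lemma 3.5 (v1: Lemma 42)] -/
private theorem p_inj' {x : Fin n → τ} {a b : Fin (n * δ) → τ} {p : Fin n → τ} {ws : Fin w → τ}
    (lay : CircLayout x a b p ws) : Function.Injective p := fun t t' h => by
  have := @lay.inj (Sum.inr (Sum.inl t)) (Sum.inr (Sum.inl t')) (by simpa using h)
  simpa using this

omit [DecidableEq τ] in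
/-- `ws` is injective (private: a generic injectivity shape). [cite: ChatterjeeTengse2023, Lemma 3.5 (v1: Lemma 42)] -/
private theorem ws_inj' {x : Fin n → τ} {a b : Fin (n * δ) → τ} {p : Fin n → τ} {ws : Fin w → τ}
    (lay : CircLayout x a b p ws) : Function.Injective ws := fun t t' h => by
  have := @lay.inj (Sum.inr (Sum.inr t)) (Sum.inr (Sum.inr t')) (by simpa using h)
  simpa using this

/-! #### Stage A: the `pow` circuits (any circuits computing `kronPow`) -/

variable (A : Fin m → ArithCircuit F τ)

/-- **Stage A**: the `m` coordinate circuits of `pow`, juxtaposed, as projection-free gates.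
[cite: ChatterjeeTengse2023, Lemma 3.5, circuits `C_ℓ(α)` / `pow` (v1: Lemma 42; p0015.txt:L86–L96)] -/
def stageAW : List (ProjCircuit.Gate F τ) :=
  (ArithCircuit.juxtGates (List.ofFn A)).map ProjCircuit.Gate.arith

/-- The stable operand reading `pow(i)_k` off stage A. [cite: ChatterjeeTengse2023, Lemma 3.5 (v1: Lemma 42)] -/
def opAW (k : Fin m) : ArithCircuit.Operand F τ :=
  (ArithCircuit.juxtOuts (List.ofFn A))[(k : ℕ)]'(by simp)

/-- **Stage A computes `pow`**: the `k`-th operand reads what `A k` computes, whatever follows.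
[cite: ChatterjeeTengse2023, Lemma 3.5 (v1: Lemma 42; p0016.txt:L1)] -/
theorem eval_opAW {pw : Fin m → MvPolynomial τ F} (hA : ∀ k, (A k).Computes (pw k)) (k : Fin m)
    (vs : List (MvPolynomial τ F)) :
    (opAW A k).eval (ProjCircuit.gateValues (stageAW A) ++ vs) = pw k := by
  rw [stageAW, ProjCircuit.gateValues_map_arith, opAW, ArithCircuit.eval_juxtOuts _ _ (by simp) vs]
  simp only [List.getElem_ofFn]
  exact hA _

omit [DecidableEq τ] [Field F] in
/-- Stage A: size. [cite: ChatterjeeTengse2023, Lemma 3.5, size count (v1: Lemma 42; p0016.txt:L5–L8)] -/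
theorem length_stageAW_le {sA : ℕ} (hAs : ∀ k, (A k).size ≤ sA) : (stageAW A).length ≤ m * sA := by
  rw [stageAW, List.length_map, ArithCircuit.length_juxtGates, List.map_ofFn, List.sum_ofFn]
  calc ∑ k : Fin m, (ArithCircuit.size ∘ A) k ≤ ∑ _k : Fin m, sA :=
        Finset.sum_le_sum fun k _ => hAs k
    _ = m * sA := by simp

omit [DecidableEq τ] [Field F] in
/-- Stage A: fan-in two, no projection gates. [cite: ChatterjeeTengse2023, Lemma 3.5 (v1: Lemma 42)] -/
theorem stageAW_spec (hA2 : ∀ k, (A k).IsFanInTwo) :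
    ∀ g ∈ stageAW A, g.fanIn ≤ 2 ∧ ∃ g', g = ProjCircuit.Gate.arith g' := by
  intro g hg
  rw [stageAW, List.mem_map] at hg
  obtain ⟨g', hg', rfl⟩ := hg
  refine ⟨?_, g', rfl⟩
  have h := ArithCircuit.fanIn_juxtGates (L := List.ofFn A) (fun Q hQ => ?_) g' hg'
  · simpa [ProjCircuit.Gate.fanIn] using h
  · simp only [List.mem_ofFn] at hQ
    obtain ⟨k, rfl⟩ := hQ
    exact hA2 k

omit [DecidableEq τ] in
/-- Stage A: sign constants, if the `A k` have them. [cite: ChatterjeeTengse2023, Lemma 3.5 "constant-free" (v1: Lemma 42; p0016.txt:L4)] -/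
theorem stageAW_signConst (hAsc : ∀ k, (A k).HasSignConstants) :
    (∀ g ∈ stageAW A, g.HasSignConstants) ∧ ∀ k, (opAW A k).HasSignConstants := by
  have hL : ∀ Q ∈ List.ofFn A, Q.HasSignConstants := fun Q hQ => by
    simp only [List.mem_ofFn] at hQ
    obtain ⟨k, rfl⟩ := hQ
    exact hAsc k
  refine ⟨fun g hg => ?_, fun k => ?_⟩
  · rw [stageAW, List.mem_map] at hg
    obtain ⟨g', hg', rfl⟩ := hg
    exact ArithCircuit.hasSignConstants_juxtGates hL g' hg'
  · exact ArithCircuit.hasSignConstants_juxtOuts hL _ (List.getElem_mem _)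

/-! #### Stage B: the row circuits with `z ↦ pow(i)` substituted -/

variable (a : Fin (n * δ) → τ) (α : F) (Δ : ℕ) (ws : Fin w → τ) (dflt : τ)
  (Q : Fin n → ProjCircuit F (Fin m ⊕ Fin w))

/-- The operands substituted into a row circuit: `z_k ↦ pow(i)_k` (stage A), workspace `↦ ws`.
[cite: ChatterjeeTengse2023, Lemma 3.5, `C_G(pow(i))` (v1: Lemma 42; p0015.txt:L97)] -/
def rowOperandsW : Fin m ⊕ Fin w → ArithCircuit.Operand F τ :=
  Sum.elim (fun k => opAW A k) (fun ω => .var (ws ω))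

/-- **Stage B**: stage A followed by the first `t` substituted row circuits.
[cite: ChatterjeeTengse2023, Lemma 3.5, `ROW` (v1: Lemma 42; p0015.txt:L97)] -/
def stageBW : ℕ → List (ProjCircuit.Gate F τ)
  | 0 => stageAW A
  | t + 1 =>
    if h : t < n then
      ((Q ⟨t, h⟩).subst (stageBW t) (rowRelabel ws dflt) (rowOperandsW A ws)).gates
    else stageBW t

/-- The stable operand reading the value of row circuit `t` (truncated past its own gates).
[cite: ChatterjeeTengse2023, Lemma 3.5, `ROW(i)_a` (v1: Lemma 42; p0016.txt:L2–L3)] -/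
def rowOutW (t : Fin n) : ArithCircuit.Operand F τ :=
  (((Q t).subst (stageBW A ws dflt Q t) (rowRelabel ws dflt) (rowOperandsW A ws)).output).truncate
    (stageBW A ws dflt Q (t + 1)).length

omit [DecidableEq τ] in
/-- Stage B unfolds at a row index. [folklore] -/
private theorem stageBW_succ (t : Fin n) :
    stageBW A ws dflt Q ((t : ℕ) + 1) =
      ((Q t).subst (stageBW A ws dflt Q t) (rowRelabel ws dflt) (rowOperandsW A ws)).gates := by
  simp [stageBW, t.isLt]

omit [DecidableEq τ] in
/-- Stage B grows by appending. [folklore] -/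
private theorem stageBW_prefix {t t' : ℕ} (h : t ≤ t') :
    ∃ rest, stageBW A ws dflt Q t' = stageBW A ws dflt Q t ++ rest := by
  induction t' with
  | zero =>
    have : t = 0 := by omega
    subst this; exact ⟨[], by simp⟩
  | succ t' ih =>
    rcases Nat.lt_or_ge t (t' + 1) with hlt | hge
    · obtain ⟨rest, hrest⟩ := ih (by omega)
      by_cases ht' : t' < n
      · refine ⟨rest ++ (Q ⟨t', ht'⟩).gates.map
          (ProjCircuit.Gate.subst (rowRelabel ws dflt) (rowOperandsW A ws) (stageBW A ws dflt Q t').length), ?_⟩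
        simp [stageBW, ht', ProjCircuit.subst, hrest]
      · exact ⟨rest, by simp [stageBW, ht', hrest]⟩
    · have : t = t' + 1 := by omega
      subst this; exact ⟨[], by simp⟩

/-- Gate values of an extension extend the gate values. [folklore] -/
private theorem gateValues_prefix' (gs rest : List (ProjCircuit.Gate F τ)) :
    ∃ vs, ProjCircuit.gateValues (gs ++ rest) = ProjCircuit.gateValues gs ++ vs := by
  induction rest using List.reverseRecOn with
  | nil => exact ⟨[], by simp⟩
  | append_singleton rest g ih =>
    obtain ⟨vs, hvs⟩ := ih
    refine ⟨vs ++ [g.eval (ProjCircuit.gateValues (gs ++ rest))], ?_⟩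
    rw [← List.append_assoc, ProjCircuit.gateValues_append_singleton, hvs, List.append_assoc]

/-- **The substituted inputs read `pow` and the workspace** against stage B at any step.
[cite: ChatterjeeTengse2023, Lemma 3.5 (v1: Lemma 42; p0015.txt:L97)] -/
theorem eval_rowOperandsW (hA : ∀ k, (A k).Computes (kronPow a α Δ k)) (t : ℕ) (i : Fin m ⊕ Fin w)
    (vs : List (MvPolynomial τ F)) :
    (rowOperandsW A ws i).eval (ProjCircuit.gateValues (stageBW A ws dflt Q t) ++ vs) =
      rowSubst a α Δ ws i := by
  cases i with
  | inl k =>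
    obtain ⟨rest, hrest⟩ := stageBW_prefix A ws dflt Q (Nat.zero_le t)
    obtain ⟨vs', hvs'⟩ := gateValues_prefix' (stageBW A ws dflt Q 0) rest
    rw [rowOperandsW, Sum.elim_inl, hrest, hvs', List.append_assoc]
    exact eval_opAW A hA k _
  | inr ω => rfl

variable {A a α Δ ws dflt Q} {x : Fin n → τ} {b : Fin (n * δ) → τ} {p : Fin n → τ}

/-- **Row copy `t` computes `(G t)(pow(i))`**, read by its stable operand against any later stage.
[cite: ChatterjeeTengse2023, Lemma 3.5, `ROW(i)_a = … g_a(pow(i)) …` (v1: Lemma 42; p0016.txt:L2–L3)] -/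
theorem eval_rowOutW (lay : CircLayout x a b p ws) (hA : ∀ k, (A k).Computes (kronPow a α Δ k))
    {G : Fin n → MvPolynomial (Fin m) F} (hQc : ∀ t, (Q t).Computes (rename Sum.inl (G t)))
    (hQp : ∀ t, (Q t).projVars ⊆ Set.range Sum.inr) (t : Fin n) {t' : ℕ} (ht : (t : ℕ) + 1 ≤ t')
    (vs : List (MvPolynomial τ F)) :
    (rowOutW A ws dflt Q t).eval (ProjCircuit.gateValues (stageBW A ws dflt Q t') ++ vs) =
      gKron a α Δ (G t) := by
  obtain ⟨rest, hrest⟩ := stageBW_prefix A ws dflt Q ht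
  obtain ⟨vs', hvs'⟩ := gateValues_prefix' (stageBW A ws dflt Q ((t : ℕ) + 1)) rest
  rw [hrest, hvs', List.append_assoc, rowOutW]
  have hlen : (stageBW A ws dflt Q ((t : ℕ) + 1)).length =
      (ProjCircuit.gateValues (stageBW A ws dflt Q ((t : ℕ) + 1))).length :=
    (ProjCircuit.gateValues_length _).symm
  rw [hlen, ArithCircuit.Operand.eval_truncate_append]
  have h := ProjCircuit.eval_subst (Q t) (stageBW A ws dflt Q t) (e := rowRelabel ws dflt)
    (ρ := rowOperandsW A ws) (h := rowSubst a α Δ ws)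
    (fun i vs => eval_rowOperandsW A a α Δ ws dflt Q hA t i vs) (substCompat_row lay t (hQp t))
  rw [ProjCircuit.eval, ← stageBW_succ] at h
  rw [h, show (Q t).eval = rename Sum.inl (G t) from hQc t, aeval_rename, gKron]
  rfl

/-! #### Stage C: the skeleton with its placeholders substituted by the row outputs -/

/-- The operands substituted into the skeleton: placeholder `p_t ↦` output of row copy `t`,
every other variable `↦` itself. [cite: ChatterjeeTengse2023, Lemma 3.5 (v1: Lemma 42; p0015.txt:L99)] -/
def skelOperandsW (A : Fin m → ArithCircuit F τ) (ws : Fin w → τ) (dflt : τ)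
    (Q : Fin n → ProjCircuit F (Fin m ⊕ Fin w)) (p : Fin n → τ) : τ → ArithCircuit.Operand F τ :=
  onBlock p (fun t => rowOutW A ws dflt Q t) (fun v => .var v)

/-- **The encoder circuit `M̃_G`, generic form**: stages A and B, then the skeleton circuit `S`
with its placeholders substituted by the row outputs. [cite: ChatterjeeTengse2023, Lemma 3.5 (v1: Lemma 42; p0015.txt:L80–L102)] -/
def encCircuitWith (A : Fin m → ArithCircuit F τ) (S : ArithCircuit F τ) (p : Fin n → τ)
    (ws : Fin w → τ) (dflt : τ) (Q : Fin n → ProjCircuit F (Fin m ⊕ Fin w)) : ProjCircuit F τ :=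
  (ProjCircuit.ofArithCircuit S).subst (stageBW A ws dflt Q n) id (skelOperandsW A ws dflt Q p)

/-- **The generic `M̃_G` computes the encoder skeleton at the pre-specialised rows `(G t)(pow(i))`.**
[cite: ChatterjeeTengse2023, Lemma 3.5 "`M̃_G(x, i, j) = M̃[i, e^{(j)}]`" (v1: Lemma 42; p0015.txt:L80–L102)] -/
theorem eval_encCircuitWith (lay : CircLayout x a b p ws) (Kb : Fin (n * δ) → Bool)
    (hA : ∀ k, (A k).Computes (kronPow a α Δ k)) {S : ArithCircuit F τ}
    (hS : S.Computes (encoderSkeleton x a b Kb (fun t => (X (p t) : MvPolynomial τ F))))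
    {G : Fin n → MvPolynomial (Fin m) F} (hQc : ∀ t, (Q t).Computes (rename Sum.inl (G t)))
    (hQp : ∀ t, (Q t).projVars ⊆ Set.range Sum.inr) :
    (encCircuitWith A S p ws dflt Q).eval = encoderSkeleton x a b Kb (fun t => gKron a α Δ (G t)) := by
  have hρ : ∀ v vs, (skelOperandsW A ws dflt Q p v).eval
      (ProjCircuit.gateValues (stageBW A ws dflt Q n) ++ vs) =
      onBlock p (fun t => gKron a α Δ (G t)) X v := by
    intro v vs
    by_cases hv : ∃ t, p t = v
    · obtain ⟨t, rfl⟩ := hv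
      rw [skelOperandsW, onBlock_blk (p_inj' lay), onBlock_blk (p_inj' lay)]
      exact eval_rowOutW lay hA hQc hQp t (Nat.succ_le_of_lt t.isLt) vs
    · have hv' : ∀ t, p t ≠ v := fun t h => hv ⟨t, h⟩
      rw [skelOperandsW, onBlock_of_ne hv', onBlock_of_ne hv']
      rfl
  have hcompat : (ProjCircuit.ofArithCircuit S).SubstCompat id
      (onBlock p (fun t => gKron a α Δ (G t)) X) := by
    intro i hi
    obtain ⟨c, u, hg⟩ := hi
    simp [ProjCircuit.ofArithCircuit] at hg
  rw [encCircuitWith, ProjCircuit.eval_subst _ _ hρ hcompat, ProjCircuit.eval_ofArithCircuit, hS]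
  -- the substitution fixes `x, a, b` and sends `p t ↦ (G t)(pow(i))`
  have hx : ∀ t, onBlock p (fun t => gKron a α Δ (G t)) X (x t) = (X (x t) : MvPolynomial τ F) :=
    fun t => onBlock_of_ne (fun t' => lay.p_ne_x t' t) _ _
  have ha : ∀ l, onBlock p (fun t => gKron a α Δ (G t)) X (a l) = (X (a l) : MvPolynomial τ F) :=
    fun l => onBlock_of_ne (fun t' => lay.p_ne_a t' l) _ _
  have hb : ∀ l, onBlock p (fun t => gKron a α Δ (G t)) X (b l) = (X (b l) : MvPolynomial τ F) :=
    fun l => onBlock_of_ne (fun t' => lay.p_ne_b t' l) _ _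
  have hp : ∀ t, onBlock p (fun t => gKron a α Δ (G t)) X (p t) = gKron a α Δ (G t) :=
    fun t => onBlock_blk (p_inj' lay) _ _ t
  have hvarA : (fun l => aeval (onBlock p (fun t => gKron a α Δ (G t)) X) (varVec (F := F) a l)) =
      varVec (F := F) a := funext fun l => by rw [varVec, aeval_X, ha]
  have hvarB : (fun l => aeval (onBlock p (fun t => gKron a α Δ (G t)) X) (varVec (F := F) b l)) =
      varVec (F := F) b := funext fun l => by rw [varVec, aeval_X, hb]
  have hconst : (fun l => aeval (onBlock p (fun t => gKron a α Δ (G t)) X) (constVec (F := F) (τ := τ) Kb l)) =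
      constVec (F := F) Kb := funext fun l => by
    cases h : Kb l <;> simp [constVec, bitVal, h]
  simp only [encoderSkeleton, actPoly, rowPolyG, colPow, map_add, map_mul, map_sub, map_one, map_prod,
    map_pow, aeval_EQ, aeval_LT, aeval_GT, hvarA, hvarB, hconst, aeval_X, hx, hb, hp]

/-- **Size of the generic `M̃_G`: `n` copies of the row circuits plus stage A plus the skeleton
circuit** ("`O((nd)³ + n·size(C_G))`"). [cite: ChatterjeeTengse2023, Lemma 3.5, size count (v1: Lemma 42; p0016.txt:L5–L8)] -/
theorem size_encCircuitWith_le {S : ArithCircuit F τ} {s sA : ℕ} (hQs : ∀ t, (Q t).size ≤ s)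
    (hAs : ∀ k, (A k).size ≤ sA) :
    (encCircuitWith A S p ws dflt Q).size ≤ n * s + m * sA + S.size := by
  have hB : ∀ t, t ≤ n → (stageBW A ws dflt Q t).length ≤ t * s + m * sA := by
    intro t
    induction t with
    | zero => intro _; simpa [stageBW] using length_stageAW_le A hAs
    | succ t ih =>
      intro ht
      have hlt : t < n := by omega
      rw [stageBW_succ A ws dflt Q ⟨t, hlt⟩]
      have := ih (by omega)
      have hs := hQs ⟨t, hlt⟩
      simp only [ProjCircuit.subst, List.length_append, List.length_map]
      rw [show (Q ⟨t, hlt⟩).gates.length = (Q ⟨t, hlt⟩).size from rfl]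
      nlinarith
  rw [encCircuitWith, ProjCircuit.size_subst, ProjCircuit.size_ofArithCircuit]
  have h1 := hB n le_rfl
  omega

omit [DecidableEq τ] in
/-- Fan-in of substituted row gates. [folklore] -/
private theorem fanIn_stageBW (hA2 : ∀ k, (A k).IsFanInTwo) (hQ2 : ∀ t, (Q t).IsFanInTwo) :
    ∀ t, ∀ g ∈ stageBW A ws dflt Q t, g.fanIn ≤ 2 := by
  intro t
  induction t with
  | zero => exact fun g hg => (stageAW_spec A hA2 g hg).1
  | succ t ih =>
    intro g hg
    by_cases ht : t < n
    · rw [stageBW_succ A ws dflt Q ⟨t, ht⟩] at hg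
      exact ProjCircuit.isFanInTwo_subst (hQ2 ⟨t, ht⟩) ih _ _ g hg
    · rw [show stageBW A ws dflt Q (t + 1) = stageBW A ws dflt Q t by simp [stageBW, ht]] at hg
      exact ih g hg

/-- **The generic `M̃_G` has fan-in two.** [cite: ChatterjeeTengse2023, Lemma 3.5 (v1: Lemma 42)] -/
theorem isFanInTwo_encCircuitWith (hA2 : ∀ k, (A k).IsFanInTwo) {S : ArithCircuit F τ}
    (hS2 : S.IsFanInTwo) (hQ2 : ∀ t, (Q t).IsFanInTwo) :
    (encCircuitWith A S p ws dflt Q).IsFanInTwo :=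
  ProjCircuit.isFanInTwo_subst (ProjCircuit.isFanInTwo_ofArithCircuit hS2) (fanIn_stageBW hA2 hQ2 n) _ _

omit [DecidableEq τ] in
/-- Projected variables of substituted row gates. [folklore] -/
private theorem proj_stageBW (hA2 : ∀ k, (A k).IsFanInTwo) (hQp : ∀ t, (Q t).projVars ⊆ Set.range Sum.inr) :
    ∀ t, ∀ i c u, ProjCircuit.Gate.proj i c u ∈ stageBW A ws dflt Q t → i ∈ Set.range ws := by
  intro t
  induction t with
  | zero =>
    intro i c u hg
    obtain ⟨-, g', hg'⟩ := stageAW_spec A hA2 _ hg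
    cases hg'
  | succ t ih =>
    intro i c u hg
    by_cases ht : t < n
    · rw [stageBW_succ A ws dflt Q ⟨t, ht⟩] at hg
      simp only [ProjCircuit.subst, List.mem_append, List.mem_map] at hg
      rcases hg with hg | ⟨g', hg', hge⟩
      · exact ih i c u hg
      · cases g' with
        | arith g => simp [ProjCircuit.Gate.subst] at hge
        | proj i' c' u' =>
          simp only [ProjCircuit.Gate.subst, ProjCircuit.Gate.proj.injEq] at hge
          obtain ⟨rfl, -, -⟩ := hge
          obtain ⟨ω, hω⟩ := hQp ⟨t, ht⟩ ⟨c', u', hg'⟩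
          rw [← hω]
          exact ⟨ω, rfl⟩
    · rw [show stageBW A ws dflt Q (t + 1) = stageBW A ws dflt Q t by simp [stageBW, ht]] at hg
      exact ih i c u hg

/-- **The generic `M̃_G` projects only the (images of the) workspace variables of the row
circuits** — not `x`, `a`, `b`: the hygiene the determinant engine (bricks E-c/E-c′/E-d) asks of
an encoder. [cite: ChatterjeeTengse2023, Lemma 3.5 with Prop. 2.28 (v1: Lemma 42, Prop. 36)] -/
theorem projVars_encCircuitWith_subset (hA2 : ∀ k, (A k).IsFanInTwo) (S : ArithCircuit F τ)
    (hQp : ∀ t, (Q t).projVars ⊆ Set.range Sum.inr) :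
    (encCircuitWith A S p ws dflt Q).projVars ⊆ Set.range ws := by
  rintro i ⟨c, u, hg⟩
  rw [encCircuitWith] at hg
  simp only [ProjCircuit.subst, List.mem_append, List.mem_map] at hg
  rcases hg with hg | ⟨g', hg', hge⟩
  · exact proj_stageBW hA2 hQp n i c u hg
  · simp only [ProjCircuit.ofArithCircuit, List.mem_map] at hg'
    obtain ⟨g'', -, rfl⟩ := hg'
    simp [ProjCircuit.Gate.subst] at hge

omit [DecidableEq τ] in
/-- Sign constants of substituted row gates and of the row outputs. [folklore] -/
private theorem signConst_stageBW (hAsc : ∀ k, (A k).HasSignConstants)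
    (hQsc : ∀ t, (Q t).HasSignConstants) :
    ∀ t, (∀ g ∈ stageBW A ws dflt Q t, g.HasSignConstants) := by
  have hρ : ∀ i, (rowOperandsW A ws i).HasSignConstants := fun i => by
    cases i with
    | inl k => exact (stageAW_signConst A hAsc).2 k
    | inr ω => exact ArithCircuit.Operand.hasSignConstants_var _
  intro t
  induction t with
  | zero => exact (stageAW_signConst A hAsc).1
  | succ t ih =>
    by_cases ht : t < n
    · rw [stageBW_succ A ws dflt Q ⟨t, ht⟩]
      exact (ProjCircuit.hasSignConstants_subst (hQsc ⟨t, ht⟩) ih _ hρ).1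
    · rw [show stageBW A ws dflt Q (t + 1) = stageBW A ws dflt Q t by simp [stageBW, ht]]
      exact ih

/-- **Constant-freeness propagates** (R4 of the assembly seat): if the `pow` circuits `A k`, the
skeleton circuit `S` and the row circuits `Q t` are constant-free, so is the generic `M̃_G`
("all the three expressions described above are constant-free, algebraic expressions").
[cite: ChatterjeeTengse2023, Lemma 3.5 (v1: Lemma 42; p0016.txt:L4)] -/
theorem hasSignConstants_encCircuitWith (hAsc : ∀ k, (A k).HasSignConstants) {S : ArithCircuit F τ}
    (hSsc : S.HasSignConstants) (hQsc : ∀ t, (Q t).HasSignConstants) :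
    (encCircuitWith A S p ws dflt Q).HasSignConstants := by
  have hρB : ∀ i, (rowOperandsW A ws i).HasSignConstants := fun i => by
    cases i with
    | inl k => exact (stageAW_signConst A hAsc).2 k
    | inr ω => exact ArithCircuit.Operand.hasSignConstants_var _
  have hout : ∀ t, (rowOutW A ws dflt Q t).HasSignConstants := fun t =>
    ((ProjCircuit.hasSignConstants_subst (hQsc t) (signConst_stageBW hAsc hQsc t) _ hρB).2).truncate _
  have hρ : ∀ v, (skelOperandsW A ws dflt Q p v).HasSignConstants := fun v => by
    by_cases hv : ∃ t, p t = v
    · obtain ⟨t, rfl⟩ := hv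
      rw [skelOperandsW]
      by_cases hinj : ∃ l, p l = p t
      · unfold onBlock; rw [dif_pos hinj]; exact hout _
      · exact absurd ⟨t, rfl⟩ hinj
    · have hv' : ∀ t, p t ≠ v := fun t h => hv ⟨t, h⟩
      rw [skelOperandsW, onBlock_of_ne hv']
      exact ArithCircuit.Operand.hasSignConstants_var _
  exact ProjCircuit.hasSignConstants_subst (ProjCircuit.hasSignConstants_ofArithCircuit hSsc)
    (signConst_stageBW hAsc hQsc n) _ hρ


/-- **The constant-free form (R4), generic in the sub-circuits.** If constant-free fan-in-two
circuits `A k` for the `pow` coordinates (e.g. `α ∈ ℕ` with square-and-multiply numerals) and `S`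
for the skeleton are supplied and the row circuits are constant-free, the encoder circuit is
constant-free, fan-in two, of size `≤ n·s + m·sA + |S|`, projects only `ws`, and computes the
encoder skeleton at the rows `(G t)(pow(i))`.
[cite: ChatterjeeTengse2023, Lemma 3.5 "constant-free, algebraic expressions" (v1: Lemma 42; p0016.txt:L4–L8)] -/
theorem exists_encoderCircuit_signConst {x : Fin n → τ} {a b : Fin (n * δ) → τ} {p : Fin n → τ}
    {ws : Fin w → τ} (lay : CircLayout x a b p ws) (dflt : τ) (Kb : Fin (n * δ) → Bool) (α : F) (Δ : ℕ)
    (G : Fin n → MvPolynomial (Fin m) F) (Q : Fin n → ProjCircuit F (Fin m ⊕ Fin w)) {s sA : ℕ}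
    (hQ2 : ∀ t, (Q t).IsFanInTwo) (hQc : ∀ t, (Q t).Computes (rename Sum.inl (G t)))
    (hQs : ∀ t, (Q t).size ≤ s) (hQp : ∀ t, (Q t).projVars ⊆ Set.range Sum.inr)
    (hQsc : ∀ t, (Q t).HasSignConstants)
    (A : Fin m → ArithCircuit F τ) (hA2 : ∀ k, (A k).IsFanInTwo)
    (hA : ∀ k, (A k).Computes (kronPow a α Δ k)) (hAs : ∀ k, (A k).size ≤ sA)
    (hAsc : ∀ k, (A k).HasSignConstants)
    (S : ArithCircuit F τ) (hS2 : S.IsFanInTwo)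
    (hS : S.Computes (encoderSkeleton x a b Kb (fun t => (X (p t) : MvPolynomial τ F))))
    (hSsc : S.HasSignConstants) :
    ∃ C : ProjCircuit F τ, C.IsFanInTwo ∧ C.HasSignConstants ∧
      C.Computes (encoderSkeleton x a b Kb (fun t => gKron a α Δ (G t))) ∧
      C.size ≤ n * s + m * sA + S.size ∧ C.projVars ⊆ Set.range ws :=
  ⟨encCircuitWith A S p ws dflt Q, isFanInTwo_encCircuitWith hA2 hS2 hQ2,
    hasSignConstants_encCircuitWith hAsc hSsc hQsc, eval_encCircuitWith lay Kb hA hS hQc hQp,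
    size_encCircuitWith_le hQs hAs, projVars_encCircuitWith_subset hA2 S hQp⟩

/-- **The general form without constant-freeness, generic in the sub-circuits** (any `A`, `S`).
[cite: ChatterjeeTengse2023, Lemma 3.5 (v1: Lemma 42; p0015.txt:L74–L102, p0016.txt:L1–L8)] -/
theorem exists_encoderCircuit_with {x : Fin n → τ} {a b : Fin (n * δ) → τ} {p : Fin n → τ}
    {ws : Fin w → τ} (lay : CircLayout x a b p ws) (dflt : τ) (Kb : Fin (n * δ) → Bool) (α : F) (Δ : ℕ)
    (G : Fin n → MvPolynomial (Fin m) F) (Q : Fin n → ProjCircuit F (Fin m ⊕ Fin w)) {s sA : ℕ}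
    (hQ2 : ∀ t, (Q t).IsFanInTwo) (hQc : ∀ t, (Q t).Computes (rename Sum.inl (G t)))
    (hQs : ∀ t, (Q t).size ≤ s) (hQp : ∀ t, (Q t).projVars ⊆ Set.range Sum.inr)
    (A : Fin m → ArithCircuit F τ) (hA2 : ∀ k, (A k).IsFanInTwo)
    (hA : ∀ k, (A k).Computes (kronPow a α Δ k)) (hAs : ∀ k, (A k).size ≤ sA)
    (S : ArithCircuit F τ) (hS2 : S.IsFanInTwo)
    (hS : S.Computes (encoderSkeleton x a b Kb (fun t => (X (p t) : MvPolynomial τ F)))) :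
    ∃ C : ProjCircuit F τ, C.IsFanInTwo ∧
      C.Computes (encoderSkeleton x a b Kb (fun t => gKron a α Δ (G t))) ∧
      C.size ≤ n * s + m * sA + S.size ∧ C.projVars ⊆ Set.range ws ∧
      ((∀ k, (A k).HasSignConstants) → S.HasSignConstants → (∀ t, (Q t).HasSignConstants) →
        C.HasSignConstants) :=
  ⟨encCircuitWith A S p ws dflt Q, isFanInTwo_encCircuitWith hA2 hS2 hQ2,
    eval_encCircuitWith lay Kb hA hS hQc hQp, size_encCircuitWith_le hQs hAs,
    projVars_encCircuitWith_subset hA2 S hQp,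
    fun hAsc hSsc hQsc => hasSignConstants_encCircuitWith hAsc hSsc hQsc⟩

end Generic


/-! ### Polynomial size bound for the skeleton (repeated squaring for `R^{2^β}`: `β` squarings,
as in print — "`O(n³ d² + n · size(C_G))`"; the file-3 bound `skelBound` charged `2^β`
multiplications, which is only polynomial at the intended parameters `2^δ ≤ 3md`) -/

section PolyBound

variable {σ : Type*}

omit [DecidableEq τ] in
/-- `L(1 − p) ≤ L(p) + 2`. [cite: Burgisser2000, Def. 2.1] -/
private theorem cx_one_sub' (p : MvPolynomial σ F) : complexity (1 - p) ≤ complexity p + 2 := by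
  have h : (1 - p : MvPolynomial σ F) = C 1 + (-1 : F) • p := by
    rw [neg_one_smul, C_1, sub_eq_add_neg]
  rw [h]
  have h1 := complexity_add_le_holds (C (1 : F) : MvPolynomial σ F) ((-1 : F) • p)
  have h2 := complexity_smul_le_holds (σ := σ) (-1 : F) p
  have h3 : complexity (C (1 : F) : MvPolynomial σ F) = 0 := complexity_C_holds (1 : F)
  omega

omit [DecidableEq τ] in
/-- **Repeated squaring**: `L(f^{2^j}) ≤ L(f) + j` (compute `f` once, square `j` times).
[cite: ChatterjeeTengse2023, Lemma 3.5, "`(ROW(i)_a)^{2^b}`" by `b` squarings (v1: Lemma 42; p0015.txt:L99, p0016.txt:L5–L8)] -/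
theorem complexity_pow_two_pow_le (f : MvPolynomial σ F) (j : ℕ) :
    complexity (f ^ 2 ^ j) ≤ complexity f + j := by
  induction j with
  | zero => simp
  | succ j ih =>
    have h := complexity_aeval_le (X () * X () : MvPolynomial Unit F) (fun _ => f ^ 2 ^ j)
    rw [map_mul, aeval_X, ← pow_two, ← pow_mul, ← pow_succ] at h
    have h1 := complexity_mul_le_holds (X () : MvPolynomial Unit F) (X ())
    have h2 := complexity_X_holds (k := F) (σ := Unit) ()
    rw [Fintype.sum_unique] at h
    omega

/-- **The polynomial size bound for the skeleton with placeholder rows** (`L = n·δ`): the file-3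
`skelBound` with the `2^δ` multiplication count replaced by `δ` squarings.
[cite: ChatterjeeTengse2023, Lemma 3.5, size count (v1: Lemma 42; p0016.txt:L5–L8)] -/
def skelBoundPoly (n δ : ℕ) : ℕ :=
  let L := n * δ
  let cLT := L * (L * 8 + 5)
  let cRow := cLT + 8 * L + 3
  2 * (cLT + 2) + (n * (δ * (cRow + δ + 4) + δ) + n) + (cLT + 4 + 8 * L + 1) + 4

variable {n δ : ℕ}

omit [DecidableEq τ] in
/-- **`L(skeleton with placeholder rows p_t) ≤ skelBoundPoly n δ`** — polynomial in `n, δ`.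
[cite: ChatterjeeTengse2023, Lemma 3.5, size count "`O(n³ d²)`" (v1: Lemma 42; p0016.txt:L5–L8)] -/
theorem complexity_encoderSkeleton_le_poly (x : Fin n → τ) (a b : Fin (n * δ) → τ)
    (Kb : Fin (n * δ) → Bool) (p : Fin n → τ) :
    complexity (encoderSkeleton x a b Kb (fun t => (X (p t) : MvPolynomial τ F))) ≤ skelBoundPoly n δ := by
  have hv : ∀ (c : Fin (n * δ) → τ) (l : Fin (n * δ)), complexity (varVec (F := F) c l) ≤ 0 :=
    fun c l => (complexity_X_holds (k := F) (c l)).le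
  have hc : ∀ l : Fin (n * δ), complexity (constVec (F := F) (τ := τ) Kb l) ≤ 0 := fun l => by
    cases h : Kb l
    · simpa [constVec, bitVal, h] using (complexity_C_holds (σ := τ) (0 : F)).le
    · simpa [constVec, bitVal, h] using (complexity_C_holds (σ := τ) (1 : F)).le
  have hLT : complexity (BitGadget.LT (n * δ) (varVec (F := F) a) (constVec Kb)) ≤ (n * δ) * ((n * δ) * 8 + 5) := by
    simpa using complexity_LT_le (F := F) 0 (n * δ) (varVec a) (constVec Kb) (hv a) hc
  have hEQ : complexity (EQ (n * δ) (varVec (F := F) a) (constVec Kb)) ≤ (n * δ) * 8 := by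
    simpa using complexity_EQ_le (F := F) 0 (n * δ) (varVec a) (constVec Kb) (hv a) hc
  have hGTa : complexity (GT (n * δ) (varVec (F := F) a) (constVec Kb)) ≤ (n * δ) * ((n * δ) * 8 + 5) := by
    simpa using complexity_GT_le (F := F) 0 (n * δ) (varVec a) (constVec Kb) (hv a) hc
  have hGTb : complexity (GT (n * δ) (varVec (F := F) b) (constVec Kb)) ≤ (n * δ) * ((n * δ) * 8 + 5) := by
    simpa using complexity_GT_le (F := F) 0 (n * δ) (varVec b) (constVec Kb) (hv b) hc
  have hEQab : complexity (EQ (n * δ) (varVec (F := F) a) (varVec b)) ≤ (n * δ) * 8 := by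
    simpa using complexity_EQ_le (F := F) 0 (n * δ) (varVec a) (varVec b) (hv a) (hv b)
  have hactA : complexity (actPoly (F := F) a Kb) ≤ (n * δ) * ((n * δ) * 8 + 5) + 2 :=
    (cx_one_sub' _).trans (by omega)
  have hactB : complexity (actPoly (F := F) b Kb) ≤ (n * δ) * ((n * δ) * 8 + 5) + 2 :=
    (cx_one_sub' _).trans (by omega)
  have hrow : ∀ t, complexity (rowPolyG x a Kb (fun t => (X (p t) : MvPolynomial τ F)) t) ≤
      (n * δ) * ((n * δ) * 8 + 5) + 8 * (n * δ) + 3 := by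
    intro t
    rw [rowPolyG]
    have h1 := complexity_mul_le_holds (BitGadget.LT (n * δ) (varVec (F := F) a) (constVec Kb)) (X (p t))
    have h2 := complexity_mul_le_holds (EQ (n * δ) (varVec (F := F) a) (constVec Kb)) (X (x t))
    have h3 := complexity_add_le_holds (BitGadget.LT (n * δ) (varVec (F := F) a) (constVec Kb) * X (p t))
      (EQ (n * δ) (varVec (F := F) a) (constVec Kb) * X (x t))
    have h4 := complexity_X_holds (k := F) (p t)
    have h5 := complexity_X_holds (k := F) (x t)
    omega
  have hcol : ∀ t, complexity (colPow b (rowPolyG x a Kb (fun t => (X (p t) : MvPolynomial τ F)) t) t) ≤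
      δ * ((n * δ) * ((n * δ) * 8 + 5) + 8 * (n * δ) + 3 + δ + 4) + δ := by
    intro t
    have h7 := hrow t
    rw [colPow]
    set R := rowPolyG x a Kb (fun t => (X (p t) : MvPolynomial τ F)) t with hR
    have hfac : ∀ β : Fin δ, complexity ((X (b (finProdFinEquiv (t, β))) * R ^ (2 ^ (β : ℕ)) +
        (1 - X (b (finProdFinEquiv (t, β))))) : MvPolynomial τ F) ≤
        (n * δ) * ((n * δ) * 8 + 5) + 8 * (n * δ) + 3 + δ + 4 := by
      intro β
      have h1 := complexity_pow_two_pow_le (F := F) R (β : ℕ)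
      have h2 : (β : ℕ) ≤ δ := β.isLt.le
      have h3 := complexity_mul_le_holds (X (b (finProdFinEquiv (t, β))) : MvPolynomial τ F) (R ^ (2 ^ (β : ℕ)))
      have h4 := cx_one_sub' (F := F) (X (b (finProdFinEquiv (t, β))) : MvPolynomial τ F)
      have h5 := complexity_add_le_holds (X (b (finProdFinEquiv (t, β))) * R ^ (2 ^ (β : ℕ)) : MvPolynomial τ F)
        (1 - X (b (finProdFinEquiv (t, β))))
      have h6 := complexity_X_holds (k := F) (b (finProdFinEquiv (t, β)))
      omega
    have hprod := complexity_finset_prod_le (Finset.univ : Finset (Fin δ))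
      (fun β => ((X (b (finProdFinEquiv (t, β))) * R ^ (2 ^ (β : ℕ)) +
        (1 - X (b (finProdFinEquiv (t, β))))) : MvPolynomial τ F))
    rw [Finset.card_univ, Fintype.card_fin] at hprod
    refine hprod.trans ?_
    have := Finset.sum_le_sum (s := (Finset.univ : Finset (Fin δ))) fun β _ => hfac β
    rw [Finset.sum_const, Finset.card_univ, Fintype.card_fin, smul_eq_mul] at this
    omega
  have hcore : complexity (∏ t : Fin n, colPow b (rowPolyG x a Kb (fun t => (X (p t) : MvPolynomial τ F)) t) t) ≤
      n * (δ * ((n * δ) * ((n * δ) * 8 + 5) + 8 * (n * δ) + 3 + δ + 4) + δ) + n := by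
    have hprod := complexity_finset_prod_le (Finset.univ : Finset (Fin n))
      (fun t => colPow b (rowPolyG x a Kb (fun t => (X (p t) : MvPolynomial τ F)) t) t)
    rw [Finset.card_univ, Fintype.card_fin] at hprod
    refine hprod.trans ?_
    have := Finset.sum_le_sum (s := (Finset.univ : Finset (Fin n))) fun t _ => hcol t
    rw [Finset.sum_const, Finset.card_univ, Fintype.card_fin, smul_eq_mul] at this
    omega
  rw [encoderSkeleton]
  have h1 := complexity_mul_le_holds (actPoly (F := F) a Kb) (actPoly b Kb)
  have h2 := complexity_mul_le_holds (actPoly (F := F) a Kb * actPoly b Kb)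
    (∏ t : Fin n, colPow b (rowPolyG x a Kb (fun t => (X (p t) : MvPolynomial τ F)) t) t)
  have h3 := cx_one_sub' (F := F) (actPoly (F := F) b Kb)
  have h4 := complexity_mul_le_holds (1 - actPoly (F := F) b Kb) (EQ (n * δ) (varVec (F := F) a) (varVec b))
  have h5 := complexity_add_le_holds
    (actPoly (F := F) a Kb * actPoly b Kb *
      ∏ t : Fin n, colPow b (rowPolyG x a Kb (fun t => (X (p t) : MvPolynomial τ F)) t) t)
    ((1 - actPoly (F := F) b Kb) * EQ (n * δ) (varVec (F := F) a) (varVec b))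
  simp only [skelBoundPoly]
  omega

/-- **Lemma 3.5, circuit form with the POLYNOMIAL size bound** `≤ n·s + m(5nδ+1) + skelBoundPoly n δ`
(no `2^δ`; supersedes the file-3 `exists_encoderCircuit` for size bookkeeping).
[cite: ChatterjeeTengse2023, Lemma 3.5 (v1: Lemma 42; p0015.txt:L74–L102, p0016.txt:L1–L8)] -/
theorem exists_encoderCircuit_poly {m w : ℕ} {x : Fin n → τ} {a b : Fin (n * δ) → τ} {p : Fin n → τ}
    {ws : Fin w → τ} (lay : CircLayout x a b p ws) (dflt : τ) (Kb : Fin (n * δ) → Bool) (α : F) (Δ : ℕ)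
    (G : Fin n → MvPolynomial (Fin m) F) (Q : Fin n → ProjCircuit F (Fin m ⊕ Fin w)) {s : ℕ}
    (hQ2 : ∀ t, (Q t).IsFanInTwo) (hQc : ∀ t, (Q t).Computes (rename Sum.inl (G t)))
    (hQs : ∀ t, (Q t).size ≤ s) (hQp : ∀ t, (Q t).projVars ⊆ Set.range Sum.inr) :
    ∃ C : ProjCircuit F τ, C.IsFanInTwo ∧
      C.Computes (encoderSkeleton x a b Kb (fun t => gKron a α Δ (G t))) ∧
      C.size ≤ n * s + m * (5 * (n * δ) + 1) + skelBoundPoly n δ ∧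
      C.projVars ⊆ Set.range ws := by
  obtain ⟨C, h2, hc, hs, hp, -⟩ := exists_encoderCircuit_with lay dflt Kb α Δ G Q hQ2 hQc hQs hQp
    (fun k => powCirc (m := m) a α Δ k) (fun k => (powCirc_spec a α Δ k).1)
    (fun k => (powCirc_spec a α Δ k).2.1)
    (fun k => by rw [(powCirc_spec a α Δ k).2.2]; exact complexity_kronPow_le a α Δ k)
    (skelCirc x a b Kb p) (skelCirc_spec x a b Kb p).1 (skelCirc_spec x a b Kb p).2.1
  refine ⟨C, h2, hc, hs.trans ?_, hp⟩
  have := complexity_encoderSkeleton_le_poly (F := F) x a b Kb p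
  rw [← (skelCirc_spec x a b Kb p).2.2] at this
  omega

end PolyBound

end CT23Encoder

end Literature.Barriers.ValiantsHypothesis
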